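import Summits.QuantumFields.BalabanUV.T4Continuum.Support.VectorLineTransport
import Summits.QuantumFields.BalabanUV.T4Continuum.Support.VariationalVectorForm

/-!
# T⁴ programme, spine node NE2 (U1a), lane P2 — SUPPLIER LEAF V-UB FOR LINE-INDEXED TRANSPORTS, part 2: `Σ‖Kφ‖² ≤ (κ⁻¹γ)²·Σ‖φ‖²`, `1 + K` INVERTIBLE on
# unit-lattice 1-forms for `κ⁻¹γ < 1` (finite-dimensional `E` — injective by the `ℓ²` bound, hence surjective), and V-UB for the printed (125)∕(3.13) transport
# structure: `∃ W, Q_T W = φ ∧ n^{2−d}·rough_R(W) ≤ 2d·(60·6^{d−1})²·((2 + n·w)² + 9)/(1 − κ⁻¹γ)²·Σ‖φ‖²`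

NE2 formalisation swarm `b2b-balaban-t4-ne2-formalise-*`, leaf 03 GEN 4 (`prover-b2b-balaban-t4-ne2-formalise-leaf-03-g4-0`); part 2 of the line-indexed V-UB (located
note N-ne2leaf03g4-1), on top of part 1 `Support/VectorLineTransport` (`QvL`, `Kdef`, `QvL_compV_eq`, `norm_Kdef_le`, `coef_facts`) and of p215552 (`compV`,
`physRoughV_compV_le`, `roughV`, `nsqV`).  The pattern is the road owner's (R1) «UB⁺ relative to a reference transport» ONE LEVEL UP: the relative phase `T∘S₀ − 1` no
longer cancels bond by bond nor block by block (the spill carries an `O(γ)` operator residue), so the corrected datum solves the BLOCK-LATTICE linear system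
`φ′ + Kφ′ = φ` — non-local in `φ` but with `Σ‖φ′‖² ≤ Σ‖φ‖²/(1 − κ⁻¹γ)²`.
 * §4 `sqrt_nsqV_add_le` (Minkowski for `nsqV`, via the scalar road's `sum_sq_add_le`), **`nsqV_Kdef_le : Σ‖Kφ‖² ≤ (κ⁻¹γ)²Σ‖φ‖²** (Minkowski in `y` per component,
   shift invariance, `a₀ + a₁ ≤ 1`), `trialV_add_apply`∕`trialV_smul_apply`, the linear map `Klin`, `eq_zero_of_nsqV_eq_zero`, `nsqV_neg`, and
   **`exists_corrected`** (`[FiniteDimensional ℂ E]`, `κ⁻¹γ < 1`): `∃ φ′, φ′ + Kφ′ = φ ∧ Σ‖φ′‖² ≤ Σ‖φ‖²/(1 − κ⁻¹γ)²` — `1 + K` injective (`√Σ‖ψ‖² ≤ κ⁻¹γ·√Σ‖ψ‖²`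
   forces `ψ = 0`), surjective by `LinearMap.injective_iff_surjective`, the bound by Minkowski on `φ′ = φ − Kφ′`;
 * §5 **`exists_ubV_line`**, **`blockSpin_vector_le_line`** (rough form) and **`exists_ubV_line_ScV`** (the road owner's `hUBc` shape for HIS fixed form `ScV` of
   `VariationalVectorForm` p216339: `∀ φ ∃ W, QvL T W = φ ∧ ScV R G W ≤ lamV d (nw) C_G (n²C₀)/(1 − κ⁻¹γ)²·nsqV φ`, via his `ScV_compV_le` at the corrected datum):
   binders = p215552's for the REFERENCE pair `(T₀, S₀)` (`T₀∘S₀ = 1`, `‖T₀‖, ‖S₀‖, ‖R‖ ≤ 1`, the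
   IN-BLOCK defect `w` of `(R, S₀, T₀)`) + the relative bound `‖T(y,j,t,μ)∘S₀(p,μ) − 1‖ ≤ γ` on the ACTUAL line transports + `κ⁻¹γ < 1` (`κ⁻¹ ≤ 60·6^{d−1}`: a
   k-UNIFORM small-field condition) ⟹ exact constraint for `QvL T` and the rough covariant Dirichlet bound with constant `2d·(60·6^{d−1})²·((2+nw)²+9)/(1 − κ⁻¹γ)²`.
NOT CLAIMED: the geometric supplier `γ ≲ n²a` for Bałaban's contour-and-line transports against a straight reference (the (O10) pattern, vector version), V-COMP for
`QvL` (composition closes in the line-indexed class: start ↦ start, position `tL + s` — a separate file), the vector FORM (owner's V-D).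

HONEST FRAMING (T4-DAG p. 1).  Model level; transports DATA; [folklore] (finite-dimensional linear algebra + lattice calculus); nothing printed is a hypothesis; one
`def` (`Klin`, a `LinearMap` packaging of `Kdef`), no `def … : Prop`, no `sorry`; axioms standard.  NE2 NOT proved; spine 0/9; rung (B)+1 finite T⁴ — NOT infinite volume,
NOT mass gap, NOT Clay.  HONEST DEPENDENCY (cell, verbatim): continuum YM on T⁴ ⇐ BetaPertH ∧ nine spine estimates (0/9 proved); BetaPertH ⇐ (D1) ∧ (D4) ∧
CAP+tail; G-an2-4 gates asym, D1 and NE2/3/4.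
-/

noncomputable section

namespace Summit.QuantumFields.BalabanUV.T4Continuum.VectorBlockTrialForm

open Finset
open scoped ComplexConjugate Matrix
open Literature.MathematicalPhysics.QuantumFieldTheory.Balaban1983to89
open Literature.MathematicalPhysics.QuantumFieldTheory.Balaban1983to89.B5Prop11Plancherel (Tor fine unitVec)
open Literature.MathematicalPhysics.QuantumFieldTheory.Balaban1983to89.B5Block118 (tstep bpt)
open Summit.QuantumFields.BalabanUV.T4Continuum.VariationalCovariantFederbush (sum_sq_add_le)
open Summit.QuantumFields.BalabanUV.T4Continuum.VariationalVectorForm (ScV lamV lamV_nonneg ScV_compV_le)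

variable {d : ℕ} (n : ℕ) [NeZero n] (M : Fin d → ℕ) [hM : ∀ μ, NeZero (M μ)]
variable {E : Type*} [NormedAddCommGroup E] [NormedSpace ℂ E]

/-! ## §4 `Σ‖Kφ‖² ≤ (κ⁻¹γ)²Σ‖φ‖²`; `1 + K` is invertible for `κ⁻¹γ < 1` -/

omit [NeZero n] [NormedSpace ℂ E] in
/-- MINKOWSKI for the `ℓ²` size of 1-forms: `√Σ‖a + b‖² ≤ √Σ‖a‖² + √Σ‖b‖²`. [folklore] -/
theorem sqrt_nsqV_add_le (a b : Tor M → Fin d → E) : Real.sqrt (nsqV M (a + b)) ≤ Real.sqrt (nsqV M a) + Real.sqrt (nsqV M b) := by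
  have hflat : ∀ g : Tor M → Fin d → E, nsqV M g = ∑ p : Tor M × Fin d, ‖g p.1 p.2‖ ^ 2 := fun g => by
    unfold nsqV; rw [Fintype.sum_prod_type]
  have h1 : nsqV M (a + b) ≤ ∑ p : Tor M × Fin d, (‖a p.1 p.2‖ + 1 * ‖b p.1 p.2‖) ^ 2 := by
    rw [hflat]
    refine sum_le_sum fun p _ => ?_
    rw [one_mul]
    exact pow_le_pow_left₀ (norm_nonneg _) (norm_add_le _ _) 2
  have h2 := sum_sq_add_le univ (fun p : Tor M × Fin d => ‖a p.1 p.2‖) (fun p => ‖b p.1 p.2‖) zero_le_one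
  rw [one_mul] at h2
  have h3 : nsqV M (a + b) ≤ (Real.sqrt (nsqV M a) + Real.sqrt (nsqV M b)) ^ 2 := by
    rw [hflat a, hflat b]; exact h1.trans h2
  calc Real.sqrt (nsqV M (a + b)) ≤ Real.sqrt ((Real.sqrt (nsqV M a) + Real.sqrt (nsqV M b)) ^ 2) := Real.sqrt_le_sqrt h3
    _ = _ := Real.sqrt_sq (by positivity)

/-- **`ℓ²` SIZE OF THE DEFECT OPERATOR**: `Σ_{y,μ}‖(Kφ)(y,μ)‖² ≤ (κ⁻¹γ)²·Σ_{y,μ}‖φ(y,μ)‖²` (Minkowski in `y` per component, shift invariance, `a₀ + a₁ ≤ 1`). [folklore] -/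
theorem nsqV_Kdef_le {T : Tor M → (Fin d → Fin n) → Fin n → Fin d → (E →L[ℂ] E)} {S₀ : Tor (fine n M) → Fin d → (E →L[ℂ] E)} {γ : ℝ}
    (hrel : ∀ y j t μ, ‖T y j t μ * S₀ (bpt n M y j + tstep (fine n M) μ t) μ - 1‖ ≤ γ) (hd : 1 ≤ d) (φ : Tor M → Fin d → E) :
    nsqV M (Kdef n M T S₀ φ) ≤ ((kappaV d n)⁻¹ * γ) ^ 2 * nsqV M φ := by
  have hn : 0 < n := Nat.pos_of_ne_zero (NeZero.ne n)
  obtain ⟨ha0, ha1, hsum⟩ := coef_facts n hd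
  set c : ℝ := (kappaV d n)⁻¹ * γ with hc
  have hc0 : 0 ≤ c := by
    have hγ0 : 0 ≤ γ := by
      obtain ⟨μ⟩ : Nonempty (Fin d) := ⟨⟨0, hd⟩⟩
      exact (norm_nonneg _).trans (hrel 0 (fun _ => 0) 0 μ)
    exact mul_nonneg (inv_pos.mpr (kappaV_pos hd hn)).le hγ0
  -- per component `μ`
  have hμ : ∀ μ : Fin d, ∑ y, ‖Kdef n M T S₀ φ y μ‖ ^ 2 ≤ c ^ 2 * ∑ y, ‖φ y μ‖ ^ 2 := by
    intro μ
    have hshift : ∑ y : Tor M, ‖φ (y + unitVec M μ) μ‖ ^ 2 = ∑ y : Tor M, ‖φ y μ‖ ^ 2 :=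
      Fintype.sum_equiv (Equiv.addRight (unitVec M μ)) _ _ fun y => rfl
    have h1 : ∑ y, ‖Kdef n M T S₀ φ y μ‖ ^ 2 ≤ ∑ y, (c * coefOwn d n * ‖φ y μ‖ + (c * coefSpill d n) * ‖φ (y + unitVec M μ) μ‖) ^ 2 := by
      refine sum_le_sum fun y _ => pow_le_pow_left₀ (norm_nonneg _) ((norm_Kdef_le n M hrel φ y μ).trans (le_of_eq (by rw [hc]; ring))) 2
    have h2 := sum_sq_add_le univ (fun y : Tor M => c * coefOwn d n * ‖φ y μ‖) (fun y => ‖φ (y + unitVec M μ) μ‖) (mul_nonneg hc0 ha1)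
    have hA : ∑ y : Tor M, (c * coefOwn d n * ‖φ y μ‖) ^ 2 = (c * coefOwn d n) ^ 2 * ∑ y, ‖φ y μ‖ ^ 2 := by
      rw [mul_sum]; exact sum_congr rfl fun y _ => by ring
    rw [hA, hshift, Real.sqrt_mul' _ (sum_nonneg fun _ _ => sq_nonneg _), Real.sqrt_sq (mul_nonneg hc0 ha0)] at h2
    calc _ ≤ _ := h1
      _ ≤ _ := h2
      _ = (c * (coefOwn d n + coefSpill d n)) ^ 2 * ∑ y, ‖φ y μ‖ ^ 2 := by
          rw [← Real.sqrt_sq (sum_nonneg fun y _ => sq_nonneg ‖φ y μ‖)] ; rw [Real.sqrt_sq (sum_nonneg fun y _ => sq_nonneg ‖φ y μ‖)]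
          have hU := Real.sq_sqrt (sum_nonneg fun y (_ : y ∈ univ) => sq_nonneg ‖φ y μ‖)
          nlinarith [hU]
      _ ≤ c ^ 2 * ∑ y, ‖φ y μ‖ ^ 2 := by
          rw [mul_pow]
          refine mul_le_mul_of_nonneg_right (mul_le_of_le_one_right (sq_nonneg _) ?_) (sum_nonneg fun _ _ => sq_nonneg _)
          exact pow_le_one₀ (add_nonneg ha0 ha1) hsum
  unfold nsqV
  conv_lhs => rw [Finset.sum_comm]
  conv_rhs => rw [Finset.sum_comm, mul_sum]
  exact sum_le_sum fun μ _ => hμ μ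

/-- the trial form is additive in the datum. [folklore] -/
theorem trialV_add_apply (φ ψ : Tor M → Fin d → E) (x : Tor (fine n M)) (μ : Fin d) :
    trialV n M (φ + ψ) x μ = trialV n M φ x μ + trialV n M ψ x μ := by
  simp only [trialV, Pi.add_apply, smul_add]

/-- the trial form is homogeneous in the datum. [folklore] -/
theorem trialV_smul_apply (c : ℂ) (φ : Tor M → Fin d → E) (x : Tor (fine n M)) (μ : Fin d) :
    trialV n M (c • φ) x μ = c • trialV n M φ x μ := by
  simp only [trialV, Pi.smul_apply, smul_comm c]

/-- the defect operator as a ℂ-LINEAR MAP on unit-lattice 1-forms. [folklore] -/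
def Klin (T : Tor M → (Fin d → Fin n) → Fin n → Fin d → (E →L[ℂ] E)) (S₀ : Tor (fine n M) → Fin d → (E →L[ℂ] E)) :
    (Tor M → Fin d → E) →ₗ[ℂ] (Tor M → Fin d → E) where
  toFun := Kdef n M T S₀
  map_add' φ ψ := by
    funext y μ
    simp only [Kdef, trialV_add_apply, Pi.add_apply, map_add, sum_add_distrib, smul_add]
  map_smul' c φ := by
    funext y μ
    simp only [Kdef, trialV_smul_apply, Pi.smul_apply, map_smul, RingHom.id_apply, ← Finset.smul_sum, smul_comm c]

omit [NeZero n] [NormedSpace ℂ E] in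
/-- `Σ‖φ‖² = 0 ⟹ φ = 0`. [folklore] -/
theorem eq_zero_of_nsqV_eq_zero {φ : Tor M → Fin d → E} (h : nsqV M φ = 0) : φ = 0 := by
  funext y μ
  have hy := (sum_eq_zero_iff_of_nonneg (fun y _ => sum_nonneg fun μ _ => sq_nonneg ‖φ y μ‖)).1 h y (mem_univ y)
  have hμ := (sum_eq_zero_iff_of_nonneg (fun μ _ => sq_nonneg ‖φ y μ‖)).1 hy μ (mem_univ μ)
  simpa using hμ

omit [NeZero n] [NormedSpace ℂ E] in
/-- `Σ‖−φ‖² = Σ‖φ‖²`. [folklore] -/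
theorem nsqV_neg (φ : Tor M → Fin d → E) : nsqV M (-φ) = nsqV M φ := by
  simp only [nsqV, Pi.neg_apply, norm_neg]

/-- **THE CORRECTED DATUM**: for `κ⁻¹γ < 1` and finite-dimensional `E`, every unit-lattice 1-form `φ` is `φ′ + Kφ′` for a unique `φ′`, and
`Σ‖φ′‖² ≤ Σ‖φ‖²/(1 − κ⁻¹γ)²` — `1 + K` is injective by the `ℓ²` bound, hence surjective (finite dimension); no Neumann series needed. [folklore] -/
theorem exists_corrected [FiniteDimensional ℂ E] {T : Tor M → (Fin d → Fin n) → Fin n → Fin d → (E →L[ℂ] E)}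
    {S₀ : Tor (fine n M) → Fin d → (E →L[ℂ] E)} {γ : ℝ} (hrel : ∀ y j t μ, ‖T y j t μ * S₀ (bpt n M y j + tstep (fine n M) μ t) μ - 1‖ ≤ γ)
    (hd : 1 ≤ d) (hc : (kappaV d n)⁻¹ * γ < 1) (φ : Tor M → Fin d → E) :
    ∃ φ' : Tor M → Fin d → E, φ' + Kdef n M T S₀ φ' = φ ∧ nsqV M φ' ≤ nsqV M φ / (1 - (kappaV d n)⁻¹ * γ) ^ 2 := by
  have hn : 0 < n := Nat.pos_of_ne_zero (NeZero.ne n)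
  set c : ℝ := (kappaV d n)⁻¹ * γ with hcdef
  have hc0 : 0 ≤ c := by
    have hγ0 : 0 ≤ γ := by
      obtain ⟨μ⟩ : Nonempty (Fin d) := ⟨⟨0, hd⟩⟩
      exact (norm_nonneg _).trans (hrel 0 (fun _ => 0) 0 μ)
    exact mul_nonneg (inv_pos.mpr (kappaV_pos hd hn)).le hγ0
  -- the `ℓ²` contraction of `K`
  have hK : ∀ ψ : Tor M → Fin d → E, Real.sqrt (nsqV M (Kdef n M T S₀ ψ)) ≤ c * Real.sqrt (nsqV M ψ) := fun ψ => by
    rw [← Real.sqrt_sq hc0, ← Real.sqrt_mul (sq_nonneg _)]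
    exact Real.sqrt_le_sqrt (nsqV_Kdef_le n M hrel hd ψ)
  let Φ : (Tor M → Fin d → E) →ₗ[ℂ] (Tor M → Fin d → E) := LinearMap.id + Klin n M T S₀
  have hΦ : ∀ ψ, Φ ψ = ψ + Kdef n M T S₀ ψ := fun ψ => rfl
  -- injective
  have hinj : Function.Injective Φ := by
    refine (injective_iff_map_eq_zero Φ).2 fun ψ hψ => ?_
    rw [hΦ] at hψ
    have hψK : ψ = -Kdef n M T S₀ ψ := eq_neg_of_add_eq_zero_left hψ
    have h1 : Real.sqrt (nsqV M ψ) ≤ c * Real.sqrt (nsqV M ψ) := by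
      calc Real.sqrt (nsqV M ψ) = Real.sqrt (nsqV M (Kdef n M T S₀ ψ)) := by rw [hψK, nsqV_neg, ← hψK]
        _ ≤ _ := hK ψ
    have h2 : Real.sqrt (nsqV M ψ) = 0 := by
      have h0 : 0 ≤ Real.sqrt (nsqV M ψ) := Real.sqrt_nonneg _
      nlinarith
    exact eq_zero_of_nsqV_eq_zero M ((Real.sqrt_eq_zero (nsqV_nonneg M ψ)).1 h2)
  -- surjective (finite dimension)
  obtain ⟨φ', hφ'⟩ := (LinearMap.injective_iff_surjective.1 hinj) φ
  refine ⟨φ', by rw [← hΦ]; exact hφ', ?_⟩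
  -- the bound: `φ′ = φ − Kφ′`
  have hdecomp : φ' = φ + -Kdef n M T S₀ φ' := by rw [← hφ', hΦ]; abel
  have h1 : Real.sqrt (nsqV M φ') ≤ Real.sqrt (nsqV M φ) + c * Real.sqrt (nsqV M φ') := by
    calc Real.sqrt (nsqV M φ') = Real.sqrt (nsqV M (φ + -Kdef n M T S₀ φ')) := by rw [← hdecomp]
      _ ≤ Real.sqrt (nsqV M φ) + Real.sqrt (nsqV M (-Kdef n M T S₀ φ')) := sqrt_nsqV_add_le M _ _
      _ ≤ _ := by rw [nsqV_neg]; exact add_le_add le_rfl (hK φ')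
  have h1c : 0 < 1 - c := by linarith
  have h2 : Real.sqrt (nsqV M φ') ≤ Real.sqrt (nsqV M φ) / (1 - c) := by
    rw [le_div_iff₀ h1c]; nlinarith
  have h3 := pow_le_pow_left₀ (Real.sqrt_nonneg _) h2 2
  rw [Real.sq_sqrt (nsqV_nonneg M φ'), div_pow, Real.sq_sqrt (nsqV_nonneg M φ)] at h3
  exact h3

/-! ## §5 LEAF V-UB FOR LINE-INDEXED TRANSPORTS: exact constraint + rough covariant Dirichlet bound with constant `Λ_V(n·w)/(1 − κ⁻¹γ)²` -/

/-- **LEAF V-UB, `∃`-form, LINE-INDEXED TRANSPORTS** (the printed (125)∕(3.13) structure; model level, `E` finite-dimensional): for line transports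
`T(y,j,t,μ)` tied to a bond-indexed contractive REFERENCE pair `(T₀, S₀)` (`T₀∘S₀ = 1`) by `‖T(y,j,t,μ)∘S₀(p,μ) − 1‖ ≤ γ` with `κ⁻¹γ < 1`, contractive parallel
transports `R` and the IN-BLOCK defect `w` of `(R, S₀, T₀)`:
`∀ φ, ∃ W, Q_T W = φ ∧ n^{2−d}·rough_R(W) ≤ 2d·(60·6^{d−1})²·((2 + n·w)² + 9)/(1 − κ⁻¹γ)²·Σ_{y,μ}‖φ(y,μ)‖²` — the competitor is `S₀·κ⁻¹ψ_{φ′}` at the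
CORRECTED datum `φ′ = (1 + K)⁻¹φ` (no longer block-local in `φ`, but the energy bound is file 2's at `φ′`). [folklore] -/
theorem exists_ubV_line [FiniteDimensional ℂ E] {T : Tor M → (Fin d → Fin n) → Fin n → Fin d → (E →L[ℂ] E)}
    {T₀ S₀ : Tor (fine n M) → Fin d → (E →L[ℂ] E)} (hTS : ∀ x μ v, T₀ x μ (S₀ x μ v) = v) (hT : ∀ x μ, ‖T₀ x μ‖ ≤ 1)
    (hS : ∀ x μ, ‖S₀ x μ‖ ≤ 1) {R : Tor (fine n M) → Fin d → (E →L[ℂ] E)} (hR : ∀ x ν, ‖R x ν‖ ≤ 1) {w : ℝ} (hw0 : 0 ≤ w)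
    (hw : ∀ (y : Tor M) (j : Fin d → Fin n) (ν μ : Fin d), (j ν : ℕ) + 1 < n →
      ‖R (bpt n M y j) ν * S₀ (bpt n M y j + unitVec (fine n M) ν) μ * T₀ (bpt n M y j) μ - 1‖ ≤ w)
    {γ : ℝ} (hrel : ∀ y j t μ, ‖T y j t μ * S₀ (bpt n M y j + tstep (fine n M) μ t) μ - 1‖ ≤ γ) (hd : 1 ≤ d)
    (hc : (kappaV d n)⁻¹ * γ < 1) :
    ∀ φ : Tor M → Fin d → E, ∃ W : Tor (fine n M) → Fin d → E, QvL n M T W = φ ∧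
      ((n : ℝ) ^ d)⁻¹ * ((n : ℝ) ^ 2 * roughV n M R W)
        ≤ 2 * d * (60 * (6 : ℝ) ^ (d - 1)) ^ 2 * ((2 + n * w) ^ 2 + 9) / (1 - (kappaV d n)⁻¹ * γ) ^ 2 * nsqV M φ := by
  intro φ
  obtain ⟨φ', hφ', hb⟩ := exists_corrected n M hrel hd hc φ
  refine ⟨compV n M S₀ φ', ?_, ?_⟩
  · funext y μ
    rw [QvL_compV_eq, ← hφ']
    rfl
  · have hE := physRoughV_compV_le n M hTS hT hS hR hw0 hw hd φ'
    have hΛ : 0 ≤ 2 * (d : ℝ) * (60 * (6 : ℝ) ^ (d - 1)) ^ 2 * ((2 + n * w) ^ 2 + 9) := by positivity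
    calc _ ≤ 2 * d * (60 * (6 : ℝ) ^ (d - 1)) ^ 2 * ((2 + n * w) ^ 2 + 9) * nsqV M φ' := hE
      _ ≤ 2 * d * (60 * (6 : ℝ) ^ (d - 1)) ^ 2 * ((2 + n * w) ^ 2 + 9) * (nsqV M φ / (1 - (kappaV d n)⁻¹ * γ) ^ 2) :=
          mul_le_mul_of_nonneg_left hb hΛ
      _ = _ := by ring

/-- **LEAF V-UB (block-spin reading), LINE-INDEXED TRANSPORTS**: `blockSpin (QvL n M T) (n^{2−d}·rough_R) φ ≤ 2d·(60·6^{d−1})²·((2 + n w)² + 9)/(1 − κ⁻¹γ)²·Σ‖φ‖²`. [folklore] -/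
theorem blockSpin_vector_le_line [FiniteDimensional ℂ E] {T : Tor M → (Fin d → Fin n) → Fin n → Fin d → (E →L[ℂ] E)}
    {T₀ S₀ : Tor (fine n M) → Fin d → (E →L[ℂ] E)} (hTS : ∀ x μ v, T₀ x μ (S₀ x μ v) = v) (hT : ∀ x μ, ‖T₀ x μ‖ ≤ 1)
    (hS : ∀ x μ, ‖S₀ x μ‖ ≤ 1) {R : Tor (fine n M) → Fin d → (E →L[ℂ] E)} (hR : ∀ x ν, ‖R x ν‖ ≤ 1) {w : ℝ} (hw0 : 0 ≤ w)
    (hw : ∀ (y : Tor M) (j : Fin d → Fin n) (ν μ : Fin d), (j ν : ℕ) + 1 < n →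
      ‖R (bpt n M y j) ν * S₀ (bpt n M y j + unitVec (fine n M) ν) μ * T₀ (bpt n M y j) μ - 1‖ ≤ w)
    {γ : ℝ} (hrel : ∀ y j t μ, ‖T y j t μ * S₀ (bpt n M y j + tstep (fine n M) μ t) μ - 1‖ ≤ γ) (hd : 1 ≤ d)
    (hc : (kappaV d n)⁻¹ * γ < 1) (φ : Tor M → Fin d → E) :
    VariationalTransfer.blockSpin (QvL n M T) (fun W => ((n : ℝ) ^ d)⁻¹ * ((n : ℝ) ^ 2 * roughV n M R W)) φ
      ≤ 2 * d * (60 * (6 : ℝ) ^ (d - 1)) ^ 2 * ((2 + n * w) ^ 2 + 9) / (1 - (kappaV d n)⁻¹ * γ) ^ 2 * nsqV M φ := by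
  have hSn : ∀ W : Tor (fine n M) → Fin d → E, 0 ≤ ((n : ℝ) ^ d)⁻¹ * ((n : ℝ) ^ 2 * roughV n M R W) := fun W => by
    have := roughV_nonneg n M R W
    positivity
  obtain ⟨W, hW, hb⟩ := exists_ubV_line n M hTS hT hS hR hw0 hw hrel hd hc φ
  exact (VariationalTransfer.blockSpin_le hSn hW).trans hb

/-- **LEAF V-UB-L IN THE OWNER's `hUBc` SHAPE** (his ruling l.≈11674 «`∀ φ, ∃ W, QvL n M T W = φ ∧ ScV n M R G W ≤ Λ·nsqV M φ`»): for the FIXED vector form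
`ScV = n^{2−d}(½curlSq + G)` of `VariationalVectorForm` (p216339) under (GF1′) `G ≤ C_G·rough + C₀·Σ‖W‖²`, LINE-indexed transports within `γ` of the bond-indexed
reference, `κ⁻¹γ < 1`: `Λ = lamV d (n·w) C_G (n²C₀) / (1 − κ⁻¹γ)²` — the owner's `ScV_compV_le` at the corrected datum `φ′`. [folklore] -/
theorem exists_ubV_line_ScV [FiniteDimensional ℂ E] {T : Tor M → (Fin d → Fin n) → Fin n → Fin d → (E →L[ℂ] E)}
    {T₀ S₀ : Tor (fine n M) → Fin d → (E →L[ℂ] E)} (hTS : ∀ x μ v, T₀ x μ (S₀ x μ v) = v) (hT : ∀ x μ, ‖T₀ x μ‖ ≤ 1)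
    (hS : ∀ x μ, ‖S₀ x μ‖ ≤ 1) {R : Tor (fine n M) → Fin d → (E →L[ℂ] E)} (hR : ∀ x ν, ‖R x ν‖ ≤ 1) {w : ℝ} (hw0 : 0 ≤ w)
    (hw : ∀ (y : Tor M) (j : Fin d → Fin n) (ν μ : Fin d), (j ν : ℕ) + 1 < n →
      ‖R (bpt n M y j) ν * S₀ (bpt n M y j + unitVec (fine n M) ν) μ * T₀ (bpt n M y j) μ - 1‖ ≤ w)
    {γ : ℝ} (hrel : ∀ y j t μ, ‖T y j t μ * S₀ (bpt n M y j + tstep (fine n M) μ t) μ - 1‖ ≤ γ) (hd : 1 ≤ d)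
    (hc : (kappaV d n)⁻¹ * γ < 1) {G : (Tor (fine n M) → Fin d → E) → ℝ} {CG C₀ : ℝ} (hCG : 0 ≤ CG) (hC₀ : 0 ≤ C₀)
    (hG : ∀ W, G W ≤ CG * roughV n M R W + C₀ * nsqV (fine n M) W) :
    ∀ φ : Tor M → Fin d → E, ∃ W : Tor (fine n M) → Fin d → E, QvL n M T W = φ ∧
      ScV n M R G W ≤ lamV d (n * w) CG ((n : ℝ) ^ 2 * C₀) / (1 - (kappaV d n)⁻¹ * γ) ^ 2 * nsqV M φ := by
  intro φ
  obtain ⟨φ', hφ', hb⟩ := exists_corrected n M hrel hd hc φ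
  refine ⟨compV n M S₀ φ', ?_, ?_⟩
  · funext y μ
    rw [QvL_compV_eq, ← hφ']
    rfl
  · have hE := ScV_compV_le n M hTS hT hS hR hw0 hw hd hCG hC₀ hG φ'
    have hΛ : 0 ≤ lamV d (n * w) CG ((n : ℝ) ^ 2 * C₀) := lamV_nonneg hCG (by positivity)
    calc _ ≤ lamV d (n * w) CG ((n : ℝ) ^ 2 * C₀) * nsqV M φ' := hE
      _ ≤ lamV d (n * w) CG ((n : ℝ) ^ 2 * C₀) * (nsqV M φ / (1 - (kappaV d n)⁻¹ * γ) ^ 2) := mul_le_mul_of_nonneg_left hb hΛ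
      _ = _ := by ring

end Summit.QuantumFields.BalabanUV.T4Continuum.VectorBlockTrialForm

end
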